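import Literature.MathematicalPhysics.QuantumFieldTheory.AbelianTorusCochains
import Literature.MathematicalPhysics.QuantumFieldTheory.CubicalStarFourCoeff
import HarnessLib

/-!
# Small closed `3`-cochains on the discrete `4`-torus are exact, with support control

Degree-three companion of `AbelianTorusCochains.lean`
(`LatticeForm.exists_td₁_eq_of_liftBox`: small closed `2`-cochains on `(ℤ/Lℤ)^d` are exact), for
cochains with values in an arbitrary additive commutative group `A` (e.g. the finite abelian group
`ker π ≅ π₁(G)` of centre-valued monopole currents of a lattice gauge field on `(ℤ/Lℤ)⁴`).

* `LatticeForm.exists_td₂_eq_of_liftBox₃` (**local filling of small closed `3`-cochains on the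
  `4`-torus**): let `m` be an `A`-valued `3`-cochain on `Site 4 L = (ℤ/Lℤ)⁴` which is closed on
  the `4`-cells, `(td₃ m)(y; 0, 1, 2, 3) = 0` (written out: the signed sum of `m` over the eight
  `3`-faces of the `4`-cell at `y` vanishes), and whose non-zero components on increasing triples
  `i < j < k` have base points with canonical coordinates (`torusSiteLift`, in `{0, …, L-1}⁴`) in a
  box `[a, b]` with `3 ≤ a`, `b ≤ L - 3`. Then there is an alternating `2`-cochain `ω` on the torus
  with `td₂ ω = m` on all increasing triples and `ω` supported (base points, canonical coordinates)
  in `[a - 2, b + 1]`. Proof: cut the torus open along the seam — the extension by zero of `m`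
  through the fundamental domain is a `3`-cochain on `ℤ⁴`, closed on the increasing `4`-cells
  (`d₂_liftCochain` pattern, the seam being away from the support) — apply the compact-support
  Poincaré lemma in degree three on `ℤ⁴` with coefficients
  (`LatticeChain.exists_d₂_eq_of_cd₃_apply_eq_zero_coeff`, Fröhlich–Spencer's Lemma 1 through
  the lattice Hodge star), and push the primitive, supported in `[a - 2, b + 1] ⊆ [1, L - 2]⁴`,
  back to the torus (`td₁_pushCochain` pattern). The lift/push are those of the degree-two file,
  applied to `(Fin 4 → A)`-valued cochains.
* `LatticeForm.exists_td₂_eq_of_liftBox₃_shift`: the same for a support contained in a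
  translate `v + [a, b]` of such a box (translation covariance of `td₂`), which is the form used
  for the clusters of a monopole current anywhere on the torus (e.g. across the seam);
  `LatticeForm.exists_sum_td₂_eq_of_liftBox₃_shift`: finitely many such pieces at once,
  `td₂ (∑_c ω_c) = ∑_c m_c` (filling a monopole current cluster by cluster).
* `LatticeForm.td₃_td₂_apply`: `td₃ (td₂ c) = 0` written out on a `4`-cell (the monopole current
  `m = td₂ c` of a `2`-cochain `c` of cell labels is closed), i.e. the closedness hypothesis of the
  theorems above for `m = td₂ c`.

Everything is proved; no definition and no named fact is introduced.

## References

* J. Fröhlich, T. Spencer, *Massless phases and symmetry restoration in abelian gauge theories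
  and spin systems*, Comm. Math. Phys. 83 (1982) 411–454, §2.3 Lemma 1 (Poincaré lemma with
  supports). [FrohlichSpencerCMP1982]
* M. P. Forsström, J. Lenells, F. Viklund, *Wilson loops in finite Abelian lattice gauge
  theories*, Ann. Inst. H. Poincaré Probab. Stat. 58 (2022), §2 Lemma 2.2. [ForsstromLenellsViklund2022]
-/

set_option autoImplicit false

open Finset Function

namespace Literature.MathematicalPhysics.QuantumFieldTheory

namespace LatticeForm

open Literature.Probability.LatticeModels (Torus.proj Torus.proj_apply)

variable {L : ℕ} {A : Type*} [AddCommGroup A]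

/-- The increasing triples of `Fin 4` are the four complementary triples `ĉ_l`, `l ∈ Fin 4`.
[folklore] -/
theorem exists_compl₃_eq : ∀ i j k : Fin 4, i < j → j < k →
    ∃ l : Fin 4, (LatticeChain.compl₃ l).1 = i ∧ (LatticeChain.compl₃ l).2.1 = j ∧
      (LatticeChain.compl₃ l).2.2 = k := by
  decide

/-- **The monopole current is closed**: `td₃ (td₂ c) = 0` on the torus `(ℤ/Lℤ)^d`, written out
on the `4`-cell at `y` spanned by `eᵢ, eⱼ, e_k, e_l` (the hypothesis `hcl` of
`exists_td₂_eq_of_liftBox₃` for `m = td₂ c` and `(i, j, k, l) = (0, 1, 2, 3)`).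
[cite: ForsstromLenellsViklund2022, §2.3.2 (dd = 0)] -/
theorem td₃_td₂_apply {d : ℕ} (c : Site d L → Fin d → Fin d → A) (y : Site d L)
    (i j k l : Fin d) :
    (td₂ c (y + te i) j k l - td₂ c y j k l) - (td₂ c (y + te j) i k l - td₂ c y i k l)
      + (td₂ c (y + te k) i j l - td₂ c y i j l) - (td₂ c (y + te l) i j k - td₂ c y i j k) = 0 := by
  simp only [td₂]
  rw [add_right_comm y (te i) (te j), add_right_comm y (te i) (te k),
    add_right_comm y (te i) (te l), add_right_comm y (te j) (te k),
    add_right_comm y (te j) (te l), add_right_comm y (te k) (te l)]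
  abel

/-- **Small closed `3`-cochains on the `4`-torus are exact, with support control** (local filling
of a small closed centre-valued monopole current). On `(ℤ/Lℤ)⁴` let `m` be an `A`-valued
`3`-cochain, closed on the `4`-cells — the signed sum of `m` over the eight `3`-faces of the
`4`-cell at `y` vanishes for every `y` (the torus analogue of `cd₃ m (y; 0, 1, 2, 3) = 0`) — whose
non-zero components on increasing triples `i < j < k` have base points with canonical
coordinates in a box `[a, b]`, `3 ≤ a`, `b ≤ L - 3`. Then `m = td₂ ω` on all increasing triples
for an alternating `2`-cochain `ω` whose non-zero plaquettes have base points with canonical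
coordinates in `[a - 2, b + 1]`. (Cut the torus open along the seam; apply the compact-support
Poincaré lemma in degree three on `ℤ⁴` with coefficients in `A`; push the primitive back.)
[cite: FrohlichSpencerCMP1982, §2.3 Lemma 1 p. 421 (Poincaré lemma with supports)] -/
theorem exists_td₂_eq_of_liftBox₃ [NeZero L] {m : Site 4 L → Fin 4 → Fin 4 → Fin 4 → A}
    {a b : Literature.Probability.LatticeModels.Site 4}
    (ha : ∀ n, 3 ≤ a n) (hb : ∀ n, b n ≤ (L : ℤ) - 3)
    (hcl : ∀ y : Site 4 L, (m (y + te 0) 1 2 3 - m y 1 2 3) - (m (y + te 1) 0 2 3 - m y 0 2 3)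
      + (m (y + te 2) 0 1 3 - m y 0 1 3) - (m (y + te 3) 0 1 2 - m y 0 1 2) = 0)
    (hsupp : ∀ y (i j k : Fin 4), i < j → j < k → m y i j k ≠ 0 → torusSiteLift y ∈ Set.Icc a b) :
    ∃ ω : Site 4 L → Fin 4 → Fin 4 → A, IsAlt ω ∧
      (∀ y (i j k : Fin 4), i < j → j < k → td₂ ω y i j k = m y i j k) ∧
      ∀ y i j, ω y i j ≠ 0 → torusSiteLift y ∈ Set.Icc (a - 2) (b + 1) := by
  classical
  -- truncate `m` to the increasing triples
  obtain ⟨m', hm'eq, hm'supp⟩ : ∃ m' : Site 4 L → Fin 4 → Fin 4 → Fin 4 → A,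
      (∀ y (i j k : Fin 4), i < j → j < k → m' y i j k = m y i j k) ∧
      ∀ y i j k, m' y i j k ≠ 0 → torusSiteLift y ∈ Set.Icc a b := by
    refine ⟨fun y i j k => if i < j ∧ j < k then m y i j k else 0,
      fun y i j k hij hjk => if_pos ⟨hij, hjk⟩, fun y i j k h => ?_⟩
    dsimp only at h
    by_cases hlt : i < j ∧ j < k
    · rw [if_pos hlt] at h
      exact hsupp y i j k hlt.1 hlt.2 h
    · rw [if_neg hlt] at h
      exact absurd rfl h
  have e123 : ∀ y, m' y 1 2 3 = m y 1 2 3 := fun y => hm'eq y 1 2 3 (by decide) (by decide)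
  have e023 : ∀ y, m' y 0 2 3 = m y 0 2 3 := fun y => hm'eq y 0 2 3 (by decide) (by decide)
  have e013 : ∀ y, m' y 0 1 3 = m y 0 1 3 := fun y => hm'eq y 0 1 3 (by decide) (by decide)
  have e012 : ∀ y, m' y 0 1 2 = m y 0 1 2 := fun y => hm'eq y 0 1 2 (by decide) (by decide)
  have hm'cl : ∀ y : Site 4 L, (m' (y + te 0) 1 2 3 - m' y 1 2 3) - (m' (y + te 1) 0 2 3 - m' y 0 2 3)
      + (m' (y + te 2) 0 1 3 - m' y 0 1 3) - (m' (y + te 3) 0 1 2 - m' y 0 1 2) = 0 := by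
    intro y
    simp only [e123, e023, e013, e012]
    exact hcl y
  -- `m'`, as a `(Fin 4 → A)`-valued `2`-cochain, is supported away from the seam
  have hbox : LiftBox (A := Fin 4 → A) m' a b := by
    refine ⟨fun n => by have := ha n; omega, fun n => by have := hb n; omega, fun y i j h => ?_⟩
    obtain ⟨k, hk⟩ := Function.ne_iff.1 h
    exact hm'supp y i j k hk
  -- the extension by zero to `ℤ⁴` is closed on the increasing `4`-cells ...
  have hQcl : ∀ x, LatticeChain.cd₃ (liftCochain (A := Fin 4 → A) m') x 0 1 2 3 = 0 := by
    intro x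
    by_cases hx : x ∈ fundBox 4 L
    · have h0 : liftCochain (A := Fin 4 → A) m' x = m' (Torus.proj L x) := by
        funext i' j'; simp [liftCochain, hx]
      simp only [LatticeChain.cd₃, h0, liftCochain_add_e hbox hx]
      exact hm'cl _
    · have h0 : ∀ i' j', liftCochain (A := Fin 4 → A) m' x i' j' = 0 := fun i' j' => by
        simp [liftCochain, hx]
      simp [LatticeChain.cd₃, liftCochain_add_e_of_not_mem hbox hx, h0]
  -- ... and supported in `[a, b]`
  have hQsupp : ∀ x (l : Fin 4), liftCochain (A := Fin 4 → A) m' x (LatticeChain.compl₃ l).1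
      (LatticeChain.compl₃ l).2.1 (LatticeChain.compl₃ l).2.2 ≠ 0 → a ≤ x ∧ x ≤ b := by
    intro x l h
    refine liftCochain_ne_zero hbox (i := (LatticeChain.compl₃ l).1)
      (j := (LatticeChain.compl₃ l).2.1) fun h0 => h ?_
    simp [h0]
  -- the Poincaré lemma with supports on `ℤ⁴`, degree three, coefficients in `A`
  obtain ⟨ω₀, hanti, hdiag, hd₂, hsupp₀⟩ :=
    LatticeChain.exists_d₂_eq_of_cd₃_apply_eq_zero_coeff a b (liftCochain (A := Fin 4 → A) m')
      hQcl hQsupp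
  -- push the primitive back to the torus
  have ha' : ∀ n, 1 ≤ (a - 2) n := fun n => by
    have := ha n; simp only [Pi.sub_apply, Pi.ofNat_apply]; omega
  have hb' : ∀ n, (b + 1) n ≤ (L : ℤ) - 2 := fun n => by
    have := hb n; simp only [Pi.add_apply, Pi.one_apply]; omega
  have hθ : ∀ x i, ω₀ x i ≠ 0 → x ∈ Set.Icc (a - 2) (b + 1) := by
    intro x i h
    obtain ⟨j, hj⟩ := Function.ne_iff.1 h
    exact hsupp₀ x i j hj
  have htd₂ : ∀ (y : Site 4 L) (i j k : Fin 4),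
      td₂ (fun (y : Site 4 L) i j => ω₀ (torusSiteLift y) i j) y i j k =
        d₂ ω₀ (torusSiteLift y) i j k := by
    intro y i j k
    simp only [td₂, d₂, apply_torusSiteLift_add_te (A := Fin 4 → A) ha' hb' hθ]
  refine ⟨fun y i j => ω₀ (torusSiteLift y) i j, ⟨fun y i j => hanti _ i j, fun y i => hdiag _ i⟩,
    fun y i j k hij hjk => ?_, fun y i j h => hsupp₀ _ i j h⟩
  obtain ⟨l, rfl, rfl, rfl⟩ := exists_compl₃_eq i j k hij hjk
  rw [htd₂, hd₂, ← hm'eq y _ _ _ hij hjk]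
  simp only [liftCochain, if_pos (torusSiteLift_mem_fundBox y), torusProj_torusSiteLift]

/-- **Translated boxes.** As `exists_td₂_eq_of_liftBox₃`, for a closed `3`-cochain whose
support (base points of non-zero increasing-triple components), translated by `-v`, has canonical
coordinates in a box `[a, b]`, `3 ≤ a`, `b ≤ L - 3`: the primitive `ω` is supported on plaquettes
whose base points, translated by `-v`, have canonical coordinates in `[a - 2, b + 1]` (translation
covariance of `td₂`; this is the form used for a small cluster of a monopole current sitting
anywhere on the torus, e.g. across the seam).
[cite: FrohlichSpencerCMP1982, §2.3 Lemma 1 p. 421 (Poincaré lemma with supports)] -/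
theorem exists_td₂_eq_of_liftBox₃_shift [NeZero L] {m : Site 4 L → Fin 4 → Fin 4 → Fin 4 → A}
    {a b : Literature.Probability.LatticeModels.Site 4} (v : Site 4 L)
    (ha : ∀ n, 3 ≤ a n) (hb : ∀ n, b n ≤ (L : ℤ) - 3)
    (hcl : ∀ y : Site 4 L, (m (y + te 0) 1 2 3 - m y 1 2 3) - (m (y + te 1) 0 2 3 - m y 0 2 3)
      + (m (y + te 2) 0 1 3 - m y 0 1 3) - (m (y + te 3) 0 1 2 - m y 0 1 2) = 0)
    (hsupp : ∀ y (i j k : Fin 4), i < j → j < k → m y i j k ≠ 0 →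
      torusSiteLift (y - v) ∈ Set.Icc a b) :
    ∃ ω : Site 4 L → Fin 4 → Fin 4 → A, IsAlt ω ∧
      (∀ y (i j k : Fin 4), i < j → j < k → td₂ ω y i j k = m y i j k) ∧
      ∀ y i j, ω y i j ≠ 0 → torusSiteLift (y - v) ∈ Set.Icc (a - 2) (b + 1) := by
  -- apply the untranslated statement to `y ↦ m (y + v)` and translate the primitive back
  obtain ⟨ω, hω, htd₂, hsuppω⟩ := exists_td₂_eq_of_liftBox₃ (m := fun y => m (y + v)) ha hb
    (fun y => by simpa only [add_right_comm y _ v] using hcl (y + v))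
    (fun y i j k hij hjk h => by
      simpa only [add_sub_cancel_right] using hsupp (y + v) i j k hij hjk h)
  refine ⟨shiftCochain₂ (-v) ω, hω.shiftCochain₂ (-v), fun y i j k hij hjk => ?_, fun y i j h => ?_⟩
  · rw [td₂_shiftCochain₂, htd₂ _ i j k hij hjk, neg_add_cancel_right]
  · have h' : ω (y + -v) i j ≠ 0 := h
    simpa only [sub_eq_add_neg] using hsuppω _ i j h'

/-- **Finitely many boxes** (local filling of a monopole current cluster by cluster). If
`m_c`, `c ∈ s`, are closed `3`-cochains on `(ℤ/Lℤ)⁴`, `m_c` supported (increasing triples,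
base points translated by `-v_c`, canonical coordinates) in a box `[a_c, b_c]`, `3 ≤ a_c`,
`b_c ≤ L - 3`, then there are alternating `2`-cochains `ω_c` with `td₂ ω_c = m_c` on increasing
triples, `ω_c` supported (same sense) in `[a_c - 2, b_c + 1]`, and consequently
`td₂ (∑_c ω_c) = ∑_c m_c` on increasing triples.
[cite: FrohlichSpencerCMP1982, §2.3 Lemma 1 p. 421 (Poincaré lemma with supports)] -/
theorem exists_sum_td₂_eq_of_liftBox₃_shift [NeZero L] {ι : Type*} (s : Finset ι)
    (mc : ι → Site 4 L → Fin 4 → Fin 4 → Fin 4 → A) (v : ι → Site 4 L)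
    (a b : ι → Literature.Probability.LatticeModels.Site 4)
    (ha : ∀ c ∈ s, ∀ n, 3 ≤ a c n) (hb : ∀ c ∈ s, ∀ n, b c n ≤ (L : ℤ) - 3)
    (hcl : ∀ c ∈ s, ∀ y : Site 4 L, (mc c (y + te 0) 1 2 3 - mc c y 1 2 3)
      - (mc c (y + te 1) 0 2 3 - mc c y 0 2 3) + (mc c (y + te 2) 0 1 3 - mc c y 0 1 3)
      - (mc c (y + te 3) 0 1 2 - mc c y 0 1 2) = 0)
    (hsupp : ∀ c ∈ s, ∀ y (i j k : Fin 4), i < j → j < k → mc c y i j k ≠ 0 →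
      torusSiteLift (y - v c) ∈ Set.Icc (a c) (b c)) :
    ∃ ω : ι → Site 4 L → Fin 4 → Fin 4 → A, (∀ c, IsAlt (ω c)) ∧
      (∀ c ∈ s, ∀ y (i j k : Fin 4), i < j → j < k → td₂ (ω c) y i j k = mc c y i j k) ∧
      (∀ c ∈ s, ∀ y i j, ω c y i j ≠ 0 →
        torusSiteLift (y - v c) ∈ Set.Icc (a c - 2) (b c + 1)) ∧
      ∀ y (i j k : Fin 4), i < j → j < k →
        td₂ (∑ c ∈ s, ω c) y i j k = ∑ c ∈ s, mc c y i j k := by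
  classical
  have key : ∀ c, ∃ ω : Site 4 L → Fin 4 → Fin 4 → A, IsAlt ω ∧ (c ∈ s →
      (∀ y (i j k : Fin 4), i < j → j < k → td₂ ω y i j k = mc c y i j k) ∧
      ∀ y i j, ω y i j ≠ 0 → torusSiteLift (y - v c) ∈ Set.Icc (a c - 2) (b c + 1)) := by
    intro c
    by_cases hc : c ∈ s
    · obtain ⟨ω, hω, h1, h2⟩ :=
        exists_td₂_eq_of_liftBox₃_shift (v c) (ha c hc) (hb c hc) (hcl c hc) (hsupp c hc)
      exact ⟨ω, hω, fun _ => ⟨h1, h2⟩⟩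
    · exact ⟨0, ⟨fun _ _ _ => by simp, fun _ _ => by simp⟩, fun h => absurd h hc⟩
  choose ω hω hrest using key
  refine ⟨ω, hω, fun c hc => (hrest c hc).1, fun c hc => (hrest c hc).2, fun y i j k hij hjk => ?_⟩
  rw [td₂_sum, Finset.sum_apply, Finset.sum_apply, Finset.sum_apply, Finset.sum_apply]
  exact Finset.sum_congr rfl fun c hc => (hrest c hc).1 y i j k hij hjk

end LatticeForm

end Literature.MathematicalPhysics.QuantumFieldTheory
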